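import Summits.QuantumFields.YangMills.Theorems.PoincareLipschitzHierAlignT3Level
import HarnessLib

/-!
# Crux stmt-QuantumFields-19936 `HistoryTailL` — THE HIERARCHICAL ALIGNMENT AT THE CRUX'S WINDOWS, ALL HEIGHTS AT ONCE («ALIGN-SIMULT»):
# ONE gauge of the finest torus aligns the WHOLE tower — `dist1 ((Ū^i(U^u)) c) ≤ B_i` for every height `i ≤ j+1` on the tower regions — and
# ONE relative gauge `g` makes every averaged pair `(Ū^i U, Ū^i(U'^g))` per-bond close at every height

Cell `ym3-torus` (YM ladder rung R3 = continuum SU(2) Yang–Mills on the three-torus — a RUNG, NOT the Clay problem; not d = 4, not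
infinite volume, not a mass gap), width seat `ym-ust-19936-w3` gen 12, `--supports stmt-QuantumFields-19936 --as helper`.  LEAD ★w1-19936 g7
word 01:07:50Z «ALIGN GO»; 01:56:36Z «F6: MINE … + ALIGN's a-priori chart for the log chart beyond j ≈ K∕2».  ✓`PoincareLipschitzHierAlignT3Level`
gives, for EACH height `i`, SOME gauge of `T^{(i)}` aligning `Ū^i U`; but the gauges of Bałaban's hierarchical axial gauge are the block-centre
RESTRICTIONS of ONE fine gauge (the root letter `u (emb y) = h y` of ✓`PoincareLipschitzHierAlignStep.exists_rootedBlockAxialGauge_SU`), and the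
averaging is gauge covariant (✓`T4Continuum.iter_gaugeAct`: `Ū^i(U^u) = (Ū^i U)^{u^{(i)}}`, `u^{(i)} = transfUp u i`).  THIS FILE carries the root
letter through the downward induction as a level-indexed family `w (i+1) y = w i (emb y)` and concludes:

* ★★★ `exists_fineGauge_iter_dist1_le_of_windows` — under hStab's hierarchical windows around `a` (`j + 3 ≤ K`, thresholds `≤ 1∕(75(L+1)²)` at the
  heights `≤ j`): ONE gauge `u` of `T^{(0)}` such that for EVERY height `i ≤ j + 1` and every level-`i` bond `c` with scaled corner within
  `8L^{j+1} + 3(L^i − 1)` of `a₋·L^{j+1}`: `dist1 ((Ū^i (U^u)) c) ≤ 50L²·Σ_{i≤i'<j+1} θBal(K−i') + 6644L²·θBal(K−j)`;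
* ★★★ `exists_relGauge_iter_dist1_le_of_windows` — for two such configurations ONE gauge `g` of `T^{(0)}` with
  `dist1 ((Ū^i (U'^g)) c · ((Ū^i U) c)⁻¹) ≤ 2·B_i` at every height on the regions: REPLACE `U'` BY `U'^g` ONCE (hStab's two sides are separately
  gauge invariant) and every averaged pair of the tower is per-bond close — the logarithms `Y_i = log((Ū^i U)_c⁻¹ (Ū^i(U'^g))_c)` exist at all
  heights with no further alignment inside the re-gauged induction (F5 ✓p686808 ∕ F6);
* ★★★ `exists_gamma_relGauge_iter_dist1_le` — THE UNIFORM FORM: `∀ τ > 0 ∃ γ₁` such that the bound is `≤ τ` at every height, every depth `j + 3 ≤ K`,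
  every cut-off, for `γ ≤ γ₁(L, b₀, p₀, τ)`.

THEOREMS ONLY, def-free; nothing of h⋆, F5∕F6, `BlockLipschitzL`, the stubs of any registered line, the crux `HistoryTailL` or a summit statement
is proved here.
-/

noncomputable section

open scoped BigOperators

namespace Summit.QuantumFields.YangMills.Theorems.PoincareLipschitzHierAlignT3Simult

open Literature.MathematicalPhysics.QuantumFieldTheory.Balaban1983to89
open Literature.MathematicalPhysics.QuantumFieldTheory.Balaban1983to89.T3ContinuumYM3Torus
open Literature.MathematicalPhysics.QuantumFieldTheory.Balaban1983to89.T3UnitLawDensityEML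
open T4Continuum BlockAveraging ExpMeanLog T3UnitScaleTilt
open Literature.MathematicalPhysics.QuantumFieldTheory.Balaban1983to89.B3Taylor310LocalRemainder (tdist_triangle tdist_comm tdist_self)
open Summit.QuantumFields.YangMills.Theorems.PoincareLipschitzHierAlignStep (exists_rootedBlockAxialGauge_SU)
open Summit.QuantumFields.YangMills.Theorems.PoincareLipschitzHierAlignTower (dist1_relGauge_le)
open Summit.QuantumFields.YangMills.Theorems.PoincareLipschitzHierAlignT3Geometry
open Summit.QuantumFields.YangMills.Theorems.PoincareLipschitzHierAlignT3 (guard_lt_deltaSU sum_range_θBal_eq_sum_image)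
open Summit.QuantumFields.YangMills.Theorems.PoincareLipschitzHierAlignT3Level (exists_hierGauge_dist1_le_of_windows_level)

variable {F : T3Family} {K j : ℕ} {γ b₀ p₀ : ℝ}

/-! ## §1 One level of the tower at the crux's windows, with the root letter -/

/-- **ONE LEVEL OF THE TOWER AT THE CRUX'S WINDOWS, ROOTED.**  Under hStab's windows around `a`, for `i ≤ j` and any gauge `h` of `T^{(i+1)}`
there is a gauge `u` of `T^{(i)}` with `u (emb y) = h y` such that every level-`i` bond `c` in the level-`i` region has
`dist1 (((Ū^i U)^u) c) ≤ 50L²·θBal(K−i) + dist1 (((Ū^{i+1} U)^h) ⟨blockOf c₋, dir c⟩)`, and the coarse bond is in the level-`(i+1)` region.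
[cite: Balaban1985Averaging, (64)-(68) p.29; Balaban1987RG1, (0.3)-(0.4) pp.252-253] -/
theorem exists_rooted_step_of_windows (hjK : j + 3 ≤ K) (hγ : 0 < γ) (hγ1 : γ ≤ 1) (hb : 0 < b₀)
    (hθσ : ∀ i, i ≤ j → θBal F.L γ b₀ p₀ (K - i) ≤ 1 / (75 * ((F.L : ℝ) + 1) ^ 2))
    (a : Plaq (F.P K) (j + 1)) (U : GaugeField (F.P K) 0 (Matrix.specialUnitaryGroup (Fin 2) ℂ))
    (hU : (∀ (i : ℕ) (q : Plaq (F.P K) i), i < j + 1 → Site.tdist (fun k => ((((q.src k).val * F.L ^ i : ℕ)) : ZMod ((F.P K).sitesPerDir 0))) (fun k => ((((a.src k).val * F.L ^ (j + 1) : ℕ)) : ZMod ((F.P K).sitesPerDir 0))) + 64 * F.L ^ i ≤ 64 * F.L ^ (j + 1) → GaugeGroup.dist1 (GaugeField.plaqHol (Averaging.iter (fun i' => BlockAveraging.blockAvg (P := F.P K) (j := i') T3UnitLawDensityEML.ℰp) i U) q) < T3UnitScaleTilt.θBal F.L γ b₀ p₀ (K - i)))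
    (i : ℕ) (hij : i ≤ j) (h : GaugeTransf (F.P K) (i + 1) (Matrix.specialUnitaryGroup (Fin 2) ℂ)) :
    ∃ u : GaugeTransf (F.P K) i (Matrix.specialUnitaryGroup (Fin 2) ℂ), (∀ y, u (emb y) = h y) ∧ ∀ c : PBond (F.P K) i,
      Site.tdist (fun k => ((((c.src k).val * F.L ^ i : ℕ)) : ZMod ((F.P K).sitesPerDir 0)))
          (fun k => ((((a.src k).val * F.L ^ (j + 1) : ℕ)) : ZMod ((F.P K).sitesPerDir 0))) ≤ 8 * F.L ^ (j + 1) + 3 * (F.L ^ i - 1) →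
      dist1 (GaugeField.gaugeAct u (Averaging.iter (fun i' => BlockAveraging.blockAvg (P := F.P K) (j := i') T3UnitLawDensityEML.ℰp) i U) c) ≤
          50 * (F.L : ℝ) ^ 2 * θBal F.L γ b₀ p₀ (K - i) +
            dist1 (GaugeField.gaugeAct h
              (Averaging.iter (fun i' => BlockAveraging.blockAvg (P := F.P K) (j := i') T3UnitLawDensityEML.ℰp) (i + 1) U) ⟨blockOf c.src, c.dir⟩) ∧
        Site.tdist (fun k => ((((blockOf c.src k).val * F.L ^ (i + 1) : ℕ)) : ZMod ((F.P K).sitesPerDir 0)))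
          (fun k => ((((a.src k).val * F.L ^ (j + 1) : ℕ)) : ZMod ((F.P K).sitesPerDir 0))) ≤ 8 * F.L ^ (j + 1) + 3 * (F.L ^ (i + 1) - 1) := by
  have hL3 : 3 ≤ F.L := (by obtain ⟨k, hk⟩ := F.hL.1; have := F.hL.2; omega)
  have hm := F.hm
  have hd : (F.P K).d = 3 := rfl
  have hi1 : i + 1 ≤ (F.P K).m + (F.P K).K := by show i + 1 ≤ F.m + K; omega
  have hθ0 : 0 ≤ θBal F.L γ b₀ p₀ (K - i) := (T3MinimiserStabilityReduction.θBal_pos (by omega) hγ hγ1 hb p₀ (K - i)).le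
  obtain ⟨u, huroot, hstep⟩ := exists_rootedBlockAxialGauge_SU (n := Fin 2) (j := i) hi1
    (Averaging.iter (fun i' => BlockAveraging.blockAvg (P := F.P K) (j := i') T3UnitLawDensityEML.ℰp) i U) h
  refine ⟨u, huroot, fun c hc => ?_⟩
  have hp1 : F.L ^ (i + 1) ≤ F.L ^ (j + 1) := Nat.pow_le_pow_right (by omega) (by omega)
  have hp2 : 3 * F.L ^ i ≤ F.L ^ (i + 1) := by rw [pow_succ, mul_comm]; exact Nat.mul_le_mul_left _ hL3
  have hLi : 1 ≤ F.L ^ i := Nat.one_le_pow _ _ (by omega)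
  have hblk : ∀ x : Site (F.P K) i, Site.tdist (fun k => ((((x k).val * F.L ^ i : ℕ)) : ZMod ((F.P K).sitesPerDir 0)))
      (fun k => ((((blockOf x k).val * F.L ^ (i + 1) : ℕ)) : ZMod ((F.P K).sitesPerDir 0))) ≤ 3 * F.L ^ (i + 1) - 3 * F.L ^ i := by
    intro x
    refine (tdist_scaled_blockOf_le (F := F) (K := K) hi1 x).trans ?_
    have e1 : (F.L - 1) * F.L ^ i + F.L ^ i = F.L ^ (i + 1) := by
      have h' : F.L - 1 + 1 = F.L := by omega
      calc (F.L - 1) * F.L ^ i + F.L ^ i = (F.L - 1 + 1) * F.L ^ i := by ring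
        _ = F.L ^ (i + 1) := by rw [h', pow_succ, mul_comm]
    omega
  -- the coarse bond is in the level-`(i+1)` region
  have hreg : Site.tdist (fun k => ((((blockOf c.src k).val * F.L ^ (i + 1) : ℕ)) : ZMod ((F.P K).sitesPerDir 0)))
      (fun k => ((((a.src k).val * F.L ^ (j + 1) : ℕ)) : ZMod ((F.P K).sitesPerDir 0))) ≤ 8 * F.L ^ (j + 1) + 3 * (F.L ^ (i + 1) - 1) := by
    have g3 := hblk c.src
    rw [tdist_comm] at g3
    have g6 := tdist_triangle (fun k => ((((blockOf c.src k).val * F.L ^ (i + 1) : ℕ)) : ZMod ((F.P K).sitesPerDir 0)))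
      (fun k => ((((c.src k).val * F.L ^ i : ℕ)) : ZMod ((F.P K).sitesPerDir 0)))
      (fun k => ((((a.src k).val * F.L ^ (j + 1) : ℕ)) : ZMod ((F.P K).sitesPerDir 0)))
    have hLi1 : 1 ≤ F.L ^ (i + 1) := Nat.one_le_pow _ _ (by omega)
    omega
  refine ⟨?_, hreg⟩
  have h2 := hstep c (θBal F.L γ b₀ p₀ (K - i)) hθ0 (fun q hq => hU i q (by omega) (by
      rw [hd] at hq
      have g1 := hblk q.src
      have g2 : Site.tdist (fun k => ((((blockOf q.src k).val * F.L ^ (i + 1) : ℕ)) : ZMod ((F.P K).sitesPerDir 0)))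
          (fun k => ((((blockOf c.src k).val * F.L ^ (i + 1) : ℕ)) : ZMod ((F.P K).sitesPerDir 0))) ≤ 6 * F.L ^ (i + 1) := by
        rw [tdist_scaled_eq (F := F) (K := K) hi1 (blockOf q.src) (blockOf c.src), mul_comm]
        exact Nat.mul_le_mul_right _ hq
      have g4 := tdist_triangle (fun k => ((((q.src k).val * F.L ^ i : ℕ)) : ZMod ((F.P K).sitesPerDir 0)))
        (fun k => ((((blockOf q.src k).val * F.L ^ (i + 1) : ℕ)) : ZMod ((F.P K).sitesPerDir 0)))
        (fun k => ((((a.src k).val * F.L ^ (j + 1) : ℕ)) : ZMod ((F.P K).sitesPerDir 0)))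
      have g5 := tdist_triangle (fun k => ((((blockOf q.src k).val * F.L ^ (i + 1) : ℕ)) : ZMod ((F.P K).sitesPerDir 0)))
        (fun k => ((((blockOf c.src k).val * F.L ^ (i + 1) : ℕ)) : ZMod ((F.P K).sitesPerDir 0)))
        (fun k => ((((a.src k).val * F.L ^ (j + 1) : ℕ)) : ZMod ((F.P K).sitesPerDir 0)))
      omega))
    (guard_lt_deltaSU (hθσ i hij))
  have e : Averaging.iter (fun i' => BlockAveraging.blockAvg (P := F.P K) (j := i') T3UnitLawDensityEML.ℰp) (i + 1) U =
      avgFun (expMeanLogSU (n := Fin 2))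
        (Averaging.iter (fun i' => BlockAveraging.blockAvg (P := F.P K) (j := i') T3UnitLawDensityEML.ℰp) i U) := rfl
  rw [e]
  have e5 : ((((F.P K).d + 2) * (F.P K).L : ℕ) : ℝ) = 5 * (F.L : ℝ) := by
    show ((((3 + 2) * F.L : ℕ)) : ℝ) = 5 * (F.L : ℝ); push_cast; ring
  rw [e5] at h2
  have e50 : 2 * ((5 * (F.L : ℝ)) ^ 2) = 50 * (F.L : ℝ) ^ 2 := by ring
  rw [e50] at h2
  exact h2

/-! ## §2 The whole tower from ONE fine gauge -/

/-- The downward induction with the root letters carried as a level-indexed family. [cite: Balaban1985Averaging, (64)-(68) p.29] -/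
theorem exists_family_of_windows (hjK : j + 3 ≤ K) (hγ : 0 < γ) (hγ1 : γ ≤ 1) (hb : 0 < b₀)
    (hθσ : ∀ i, i ≤ j → θBal F.L γ b₀ p₀ (K - i) ≤ 1 / (75 * ((F.L : ℝ) + 1) ^ 2))
    (a : Plaq (F.P K) (j + 1)) (U : GaugeField (F.P K) 0 (Matrix.specialUnitaryGroup (Fin 2) ℂ))
    (hU : (∀ (i : ℕ) (q : Plaq (F.P K) i), i < j + 1 → Site.tdist (fun k => ((((q.src k).val * F.L ^ i : ℕ)) : ZMod ((F.P K).sitesPerDir 0))) (fun k => ((((a.src k).val * F.L ^ (j + 1) : ℕ)) : ZMod ((F.P K).sitesPerDir 0))) + 64 * F.L ^ i ≤ 64 * F.L ^ (j + 1) → GaugeGroup.dist1 (GaugeField.plaqHol (Averaging.iter (fun i' => BlockAveraging.blockAvg (P := F.P K) (j := i') T3UnitLawDensityEML.ℰp) i U) q) < T3UnitScaleTilt.θBal F.L γ b₀ p₀ (K - i))) :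
    ∀ (N i : ℕ), i + N = j + 1 →
      ∃ w : (i' : ℕ) → GaugeTransf (F.P K) i' (Matrix.specialUnitaryGroup (Fin 2) ℂ),
        (∀ i', i ≤ i' → i' ≤ j → ∀ y : Site (F.P K) (i' + 1), w i' (emb y) = w (i' + 1) y) ∧
        ∀ i', i ≤ i' → i' ≤ j + 1 → ∀ c : PBond (F.P K) i',
          Site.tdist (fun k => ((((c.src k).val * F.L ^ i' : ℕ)) : ZMod ((F.P K).sitesPerDir 0)))
              (fun k => ((((a.src k).val * F.L ^ (j + 1) : ℕ)) : ZMod ((F.P K).sitesPerDir 0))) ≤ 8 * F.L ^ (j + 1) + 3 * (F.L ^ i' - 1) →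
          dist1 (GaugeField.gaugeAct (w i') (Averaging.iter (fun i'' => BlockAveraging.blockAvg (P := F.P K) (j := i'') T3UnitLawDensityEML.ℰp) i' U) c) ≤
            50 * (F.L : ℝ) ^ 2 * (∑ i'' ∈ Finset.Ico i' (j + 1), θBal F.L γ b₀ p₀ (K - i'')) + 6644 * (F.L : ℝ) ^ 2 * θBal F.L γ b₀ p₀ (K - j) := by
  intro N
  induction N with
  | zero =>
    intro i hi
    rw [Nat.add_zero] at hi
    subst hi
    obtain ⟨uTop, huTop⟩ := exists_hierGauge_dist1_le_of_windows_level hjK hγ hγ1 hb hθσ a U hU (j + 1) le_rfl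
    refine ⟨fun i' => if h : i' = j + 1 then h ▸ uTop else fun _ => 1, fun i' h1 h2 => by omega, fun i' h1 h2 c hc => ?_⟩
    obtain rfl : i' = j + 1 := le_antisymm h2 h1
    simp only [dif_pos]
    exact huTop c hc
  | succ N ih =>
    intro i hi
    have hij : i ≤ j := by omega
    obtain ⟨w, hroot, hchart⟩ := ih (i + 1) (by omega)
    obtain ⟨u, huroot, hstep⟩ := exists_rooted_step_of_windows hjK hγ hγ1 hb hθσ a U hU i hij (w (i + 1))
    refine ⟨fun i' => if h : i' = i then h ▸ u else w i', fun i' h1 h2 y => ?_, fun i' h1 h2 c hc => ?_⟩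
    · -- root letters
      by_cases hi' : i' = i
      · subst hi'
        have hne : i' + 1 ≠ i' := by omega
        simp only [dif_pos, hne, dif_neg, not_false_eq_true]
        exact huroot y
      · have hne : i' + 1 ≠ i := by omega
        simp only [hi', hne, dif_neg, not_false_eq_true]
        exact hroot i' (by omega) h2 y
    · -- charts
      by_cases hi' : i' = i
      · subst hi'
        have hne : i' + 1 ≠ i' := by omega
        simp only [dif_pos]
        obtain ⟨hb1, hreg⟩ := hstep c hc
        have hb2 := hchart (i' + 1) le_rfl (by omega) ⟨blockOf c.src, c.dir⟩ hreg
        rw [Finset.sum_eq_sum_Ico_succ_bot (by omega : i' < j + 1), mul_add]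
        linarith
      · simp only [hi', dif_neg, not_false_eq_true]
        exact hchart i' (by omega) h2 c hc

/-- ★★★ **ONE FINE GAUGE ALIGNS THE WHOLE TOWER.**  Let `j + 3 ≤ K`, `0 < γ ≤ 1`, `0 < b₀`, thresholds `θBal(K−i) ≤ 1∕(75(L+1)²)` at the heights
`i ≤ j`, and let `U` satisfy hStab's hierarchical windows around the level-`(j+1)` plaquette `a`.  Then ONE gauge `u` of the finest torus makes, for
EVERY height `i ≤ j + 1`, every level-`i` bond `c` of `Ū^i(U^u)` with scaled corner within `8L^{j+1} + 3(L^i − 1)` of `a₋·L^{j+1}` satisfy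
`dist1 ((Ū^i (U^u)) c) ≤ 50·L²·Σ_{i≤i'<j+1} θBal(K−i') + 6644·L²·θBal(K−j)` — Bałaban's hierarchical axial gauge: the level-`i` gauges are the
block-centre restrictions `u^{(i)} = transfUp u i` of the fine one, and `Ū^i(U^u) = (Ū^i U)^{u^{(i)}}` (✓`iter_gaugeAct`).
[cite: Balaban1985Averaging, (64)-(68) p.29, (11) p.19] -/
theorem exists_fineGauge_iter_dist1_le_of_windows (hjK : j + 3 ≤ K) (hγ : 0 < γ) (hγ1 : γ ≤ 1) (hb : 0 < b₀)
    (hθσ : ∀ i, i ≤ j → θBal F.L γ b₀ p₀ (K - i) ≤ 1 / (75 * ((F.L : ℝ) + 1) ^ 2))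
    (a : Plaq (F.P K) (j + 1)) (U : GaugeField (F.P K) 0 (Matrix.specialUnitaryGroup (Fin 2) ℂ))
    (hU : (∀ (i : ℕ) (q : Plaq (F.P K) i), i < j + 1 → Site.tdist (fun k => ((((q.src k).val * F.L ^ i : ℕ)) : ZMod ((F.P K).sitesPerDir 0))) (fun k => ((((a.src k).val * F.L ^ (j + 1) : ℕ)) : ZMod ((F.P K).sitesPerDir 0))) + 64 * F.L ^ i ≤ 64 * F.L ^ (j + 1) → GaugeGroup.dist1 (GaugeField.plaqHol (Averaging.iter (fun i' => BlockAveraging.blockAvg (P := F.P K) (j := i') T3UnitLawDensityEML.ℰp) i U) q) < T3UnitScaleTilt.θBal F.L γ b₀ p₀ (K - i))) :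
    ∃ u : GaugeTransf (F.P K) 0 (Matrix.specialUnitaryGroup (Fin 2) ℂ), ∀ (i : ℕ), i ≤ j + 1 → ∀ c : PBond (F.P K) i,
      Site.tdist (fun k => ((((c.src k).val * F.L ^ i : ℕ)) : ZMod ((F.P K).sitesPerDir 0)))
          (fun k => ((((a.src k).val * F.L ^ (j + 1) : ℕ)) : ZMod ((F.P K).sitesPerDir 0))) ≤ 8 * F.L ^ (j + 1) + 3 * (F.L ^ i - 1) →
      dist1 (Averaging.iter (fun i' => BlockAveraging.blockAvg (P := F.P K) (j := i') T3UnitLawDensityEML.ℰp) i (GaugeField.gaugeAct u U) c) ≤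
        50 * (F.L : ℝ) ^ 2 * (∑ i' ∈ Finset.Ico i (j + 1), θBal F.L γ b₀ p₀ (K - i')) + 6644 * (F.L : ℝ) ^ 2 * θBal F.L γ b₀ p₀ (K - j) := by
  have hm := F.hm
  obtain ⟨w, hroot, hchart⟩ := exists_family_of_windows hjK hγ hγ1 hb hθσ a U hU (j + 1) 0 (by omega)
  refine ⟨w 0, fun i hi c hc => ?_⟩
  -- the block-centre restrictions of `w 0` are the family `w`
  have hup : ∀ i', i' ≤ j + 1 → transfUp (w 0) i' = w i' := by
    intro i'
    induction i' with
    | zero => intro; rfl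
    | succ i' ih =>
      intro hi'
      funext y
      show transfUp (w 0) i' (emb y) = w (i' + 1) y
      rw [ih (by omega)]
      exact hroot i' (Nat.zero_le _) (by omega) y
  have hiK : i ≤ (F.P K).m + (F.P K).K := by show i ≤ F.m + K; omega
  rw [iter_gaugeAct _ (w 0) i hiK U, hup i hi]
  exact hchart i (Nat.zero_le _) hi c hc

/-- Block-centre restriction of a pointwise product `x ↦ (u x)⁻¹·u' x`. [folklore] -/
theorem transfUp_inv_mul {P : Params} {G : Type*} [GaugeGroup G] (u u' : GaugeTransf P 0 G) :
    ∀ i : ℕ, transfUp (fun x => (u x)⁻¹ * u' x) i = fun y => (transfUp u i y)⁻¹ * transfUp u' i y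
  | 0 => rfl
  | i + 1 => by
    funext y
    show transfUp (fun x => (u x)⁻¹ * u' x) i (emb y) = (transfUp u i (emb y))⁻¹ * transfUp u' i (emb y)
    rw [transfUp_inv_mul u u' i]

/-- ★★★ **ONE RELATIVE GAUGE ALIGNS EVERY AVERAGED PAIR OF THE TOWER.**  Under the hypotheses of `exists_fineGauge_iter_dist1_le_of_windows` for TWO
configurations `U, U'`, ONE gauge `g` of the finest torus gives, at EVERY height `i ≤ j + 1` and on every level-`i` bond `c` with scaled corner within
`8L^{j+1} + 3(L^i − 1)` of `a₋·L^{j+1}`, `dist1 ((Ū^i (U'^g)) c · ((Ū^i U) c)⁻¹) ≤ 2·(50L²·Σ_{i≤i'<j+1} θBal(K−i') + 6644L²·θBal(K−j))` — replace `U'`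
by `U'^g` once, and the whole tower of averaged pairs is per-bond close. [cite: Balaban1985Averaging, (64)-(68) p.29, (11) p.19] -/
theorem exists_relGauge_iter_dist1_le_of_windows (hjK : j + 3 ≤ K) (hγ : 0 < γ) (hγ1 : γ ≤ 1) (hb : 0 < b₀)
    (hθσ : ∀ i, i ≤ j → θBal F.L γ b₀ p₀ (K - i) ≤ 1 / (75 * ((F.L : ℝ) + 1) ^ 2))
    (a : Plaq (F.P K) (j + 1)) (U U' : GaugeField (F.P K) 0 (Matrix.specialUnitaryGroup (Fin 2) ℂ))
    (hU : (∀ (i : ℕ) (q : Plaq (F.P K) i), i < j + 1 → Site.tdist (fun k => ((((q.src k).val * F.L ^ i : ℕ)) : ZMod ((F.P K).sitesPerDir 0))) (fun k => ((((a.src k).val * F.L ^ (j + 1) : ℕ)) : ZMod ((F.P K).sitesPerDir 0))) + 64 * F.L ^ i ≤ 64 * F.L ^ (j + 1) → GaugeGroup.dist1 (GaugeField.plaqHol (Averaging.iter (fun i' => BlockAveraging.blockAvg (P := F.P K) (j := i') T3UnitLawDensityEML.ℰp) i U) q) < T3UnitScaleTilt.θBal F.L γ b₀ p₀ (K - i)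))
    (hU' : (∀ (i : ℕ) (q : Plaq (F.P K) i), i < j + 1 → Site.tdist (fun k => ((((q.src k).val * F.L ^ i : ℕ)) : ZMod ((F.P K).sitesPerDir 0))) (fun k => ((((a.src k).val * F.L ^ (j + 1) : ℕ)) : ZMod ((F.P K).sitesPerDir 0))) + 64 * F.L ^ i ≤ 64 * F.L ^ (j + 1) → GaugeGroup.dist1 (GaugeField.plaqHol (Averaging.iter (fun i' => BlockAveraging.blockAvg (P := F.P K) (j := i') T3UnitLawDensityEML.ℰp) i U') q) < T3UnitScaleTilt.θBal F.L γ b₀ p₀ (K - i))) :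
    ∃ g : GaugeTransf (F.P K) 0 (Matrix.specialUnitaryGroup (Fin 2) ℂ), ∀ (i : ℕ), i ≤ j + 1 → ∀ c : PBond (F.P K) i,
      Site.tdist (fun k => ((((c.src k).val * F.L ^ i : ℕ)) : ZMod ((F.P K).sitesPerDir 0)))
          (fun k => ((((a.src k).val * F.L ^ (j + 1) : ℕ)) : ZMod ((F.P K).sitesPerDir 0))) ≤ 8 * F.L ^ (j + 1) + 3 * (F.L ^ i - 1) →
      dist1 (Averaging.iter (fun i' => BlockAveraging.blockAvg (P := F.P K) (j := i') T3UnitLawDensityEML.ℰp) i (GaugeField.gaugeAct g U') c *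
          (Averaging.iter (fun i' => BlockAveraging.blockAvg (P := F.P K) (j := i') T3UnitLawDensityEML.ℰp) i U c)⁻¹) ≤
        2 * (50 * (F.L : ℝ) ^ 2 * (∑ i' ∈ Finset.Ico i (j + 1), θBal F.L γ b₀ p₀ (K - i')) + 6644 * (F.L : ℝ) ^ 2 * θBal F.L γ b₀ p₀ (K - j)) := by
  have hm := F.hm
  obtain ⟨u, hu⟩ := exists_fineGauge_iter_dist1_le_of_windows hjK hγ hγ1 hb hθσ a U hU
  obtain ⟨u', hu'⟩ := exists_fineGauge_iter_dist1_le_of_windows hjK hγ hγ1 hb hθσ a U' hU'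
  refine ⟨fun x => (u x)⁻¹ * u' x, fun i hi c hc => ?_⟩
  have hiK : i ≤ (F.P K).m + (F.P K).K := by show i ≤ F.m + K; omega
  have h1 := hu i hi c hc
  have h2 := hu' i hi c hc
  rw [iter_gaugeAct _ u i hiK U] at h1
  rw [iter_gaugeAct _ u' i hiK U'] at h2
  rw [iter_gaugeAct _ _ i hiK U', transfUp_inv_mul u u' i]
  have h := dist1_relGauge_le _ _ (transfUp u i) (transfUp u' i) c h1 h2
  linarith

/-- ★★★ **THE UNIFORM FORM: ONE RELATIVE GAUGE, A SUP-CHART `τ` ON THE WHOLE TOWER, AT EVERY DEPTH AND CUT-OFF.**  For every `L ≥ 2`, `b₀ > 0`,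
`p₀ > 0` and `τ > 0` there is `γ₁ ∈ (0, 1]` such that for every member `F` with `F.L = L`, every `0 < γ ≤ γ₁`, every `K`, `j` with `j + 3 ≤ K`,
every level-`(j+1)` plaquette `a` and every two configurations `U, U'` with hStab's hierarchical windows around `a`, ONE gauge `g` of the finest
torus gives `dist1 ((Ū^i (U'^g)) c · ((Ū^i U) c)⁻¹) ≤ τ` at EVERY height `i ≤ j + 1` on every level-`i` bond with scaled corner within
`8L^{j+1} + 3(L^i − 1)` of `a₋·L^{j+1}`. [cite: Balaban1985Averaging, (64)-(68) p.29; Balaban1985UV3, (7) p.257] -/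
theorem exists_gamma_relGauge_iter_dist1_le (L : ℕ) (hL : 2 ≤ L) {b₀ p₀ : ℝ} (hb : 0 < b₀) (hp : 0 < p₀) {τ : ℝ} (hτ : 0 < τ) :
    ∃ γ₁ : ℝ, 0 < γ₁ ∧ γ₁ ≤ 1 ∧ ∀ (F : T3Family) (γ : ℝ), F.L = L → 0 < γ → γ ≤ γ₁ →
      ∀ (K j : ℕ), j + 3 ≤ K → ∀ (a : Plaq (F.P K) (j + 1)) (U U' : GaugeField (F.P K) 0 (Matrix.specialUnitaryGroup (Fin 2) ℂ)),
        (∀ (i : ℕ) (q : Plaq (F.P K) i), i < j + 1 → Site.tdist (fun k => ((((q.src k).val * F.L ^ i : ℕ)) : ZMod ((F.P K).sitesPerDir 0))) (fun k => ((((a.src k).val * F.L ^ (j + 1) : ℕ)) : ZMod ((F.P K).sitesPerDir 0))) + 64 * F.L ^ i ≤ 64 * F.L ^ (j + 1) → GaugeGroup.dist1 (GaugeField.plaqHol (Averaging.iter (fun i' => BlockAveraging.blockAvg (P := F.P K) (j := i') T3UnitLawDensityEML.ℰp) i U) q) < T3UnitScaleTilt.θBal F.L γ b₀ p₀ (K -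 i)) →
        (∀ (i : ℕ) (q : Plaq (F.P K) i), i < j + 1 → Site.tdist (fun k => ((((q.src k).val * F.L ^ i : ℕ)) : ZMod ((F.P K).sitesPerDir 0))) (fun k => ((((a.src k).val * F.L ^ (j + 1) : ℕ)) : ZMod ((F.P K).sitesPerDir 0))) + 64 * F.L ^ i ≤ 64 * F.L ^ (j + 1) → GaugeGroup.dist1 (GaugeField.plaqHol (Averaging.iter (fun i' => BlockAveraging.blockAvg (P := F.P K) (j := i') T3UnitLawDensityEML.ℰp) i U') q) < T3UnitScaleTilt.θBal F.L γ b₀ p₀ (K - i)) →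
        ∃ g : GaugeTransf (F.P K) 0 (Matrix.specialUnitaryGroup (Fin 2) ℂ), ∀ (i : ℕ), i ≤ j + 1 → ∀ c : PBond (F.P K) i,
          Site.tdist (fun k => ((((c.src k).val * F.L ^ i : ℕ)) : ZMod ((F.P K).sitesPerDir 0)))
              (fun k => ((((a.src k).val * F.L ^ (j + 1) : ℕ)) : ZMod ((F.P K).sitesPerDir 0))) ≤ 8 * F.L ^ (j + 1) + 3 * (F.L ^ i - 1) →
          dist1 (Averaging.iter (fun i' => BlockAveraging.blockAvg (P := F.P K) (j := i') T3UnitLawDensityEML.ℰp) i (GaugeField.gaugeAct g U') c *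
              (Averaging.iter (fun i' => BlockAveraging.blockAvg (P := F.P K) (j := i') T3UnitLawDensityEML.ℰp) i U c)⁻¹) ≤ τ := by
  obtain ⟨γa, hγa, hγa1, hθa⟩ := T3Thresholds.exists_gamma_forall_θBal_le (b₀ := b₀) (p₀ := p₀) hb hp
    (σ := 1 / (75 * ((L : ℝ) + 1) ^ 2)) (by positivity)
  set σ : ℝ := τ / (2 * (50 + 6644) * (L : ℝ) ^ 2) with hσ
  have hL0 : (0 : ℝ) < L := by exact_mod_cast (show 0 < L by omega)
  have hσ0 : 0 < σ := by rw [hσ]; positivity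
  obtain ⟨γs, hγs, hγs1, hθs⟩ := PoincareLipschitzThresholdSums.exists_gamma_forall_sum_θBal_le (b₀ := b₀) (p₀ := p₀) hb hp hσ0
  refine ⟨min γa γs, lt_min hγa hγs, (min_le_left _ _).trans hγa1, ?_⟩
  intro F γ hFL hγ hγ1 K j hjK a U U' hU hU'
  subst hFL
  have hγa' : γ ≤ γa := hγ1.trans (min_le_left _ _)
  have hγs' : γ ≤ γs := hγ1.trans (min_le_right _ _)
  have hγone : γ ≤ 1 := hγa'.trans hγa1
  have hθσ : ∀ i', i' ≤ j → θBal F.L γ b₀ p₀ (K - i') ≤ 1 / (75 * ((F.L : ℝ) + 1) ^ 2) :=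
    fun i' _ => hθa F.L (by omega) γ hγ hγa' (K - i')
  obtain ⟨g, hg⟩ := exists_relGauge_iter_dist1_le_of_windows hjK hγ hγone hb hθσ a U U' hU hU'
  refine ⟨g, fun i hi c hc => (hg i hi c hc).trans ?_⟩
  have hsum : ∑ i' ∈ Finset.Ico i (j + 1), θBal F.L γ b₀ p₀ (K - i') ≤ σ := by
    have hsub : ∑ i' ∈ Finset.Ico i (j + 1), θBal F.L γ b₀ p₀ (K - i') ≤ ∑ i' ∈ Finset.range (j + 1), θBal F.L γ b₀ p₀ (K - i') := by
      refine Finset.sum_le_sum_of_subset_of_nonneg ?_ fun i' _ _ =>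
        (T3MinimiserStabilityReduction.θBal_pos (by omega) hγ hγone hb p₀ (K - i')).le
      intro x hx
      simp only [Finset.mem_Ico] at hx
      simp only [Finset.mem_range]
      exact hx.2
    refine hsub.trans ?_
    rw [sum_range_θBal_eq_sum_image (by omega)]
    exact hθs F.L hL γ hγ hγs' _
  have htop : θBal F.L γ b₀ p₀ (K - j) ≤ σ := by
    have h := hθs F.L hL γ hγ hγs' {K - j}
    rwa [Finset.sum_singleton] at h
  calc 2 * (50 * (F.L : ℝ) ^ 2 * (∑ i' ∈ Finset.Ico i (j + 1), θBal F.L γ b₀ p₀ (K - i')) + 6644 * (F.L : ℝ) ^ 2 * θBal F.L γ b₀ p₀ (K - j))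
      ≤ 2 * (50 * (F.L : ℝ) ^ 2 * σ + 6644 * (F.L : ℝ) ^ 2 * σ) := by
        have h1 := mul_le_mul_of_nonneg_left hsum (by positivity : (0 : ℝ) ≤ 50 * (F.L : ℝ) ^ 2)
        have h2 := mul_le_mul_of_nonneg_left htop (by positivity : (0 : ℝ) ≤ 6644 * (F.L : ℝ) ^ 2)
        linarith
    _ = τ := by rw [hσ]; field_simp

end Summit.QuantumFields.YangMills.Theorems.PoincareLipschitzHierAlignT3Simult

end
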